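import Summits.AtomisticToContinuum.Crystallization.Theses.EnergyDerivativeOrder

/-!
# Route `EnergyDerivativeOrder`, item stmt-AtomisticToContinuum-12283 `SupergradientSandwich`

The supergradient sandwich (the soft transfer principle of the route): `N ↦ E_V(N)` is an infimum
of functionals that are linear in the pair potential `V`, hence concave in `V`; testing
`V_LJ ± tW` on a `V_LJ`-ground state `x^N` gives, for `t > 0`,

`(E_{LJ+tW}(N) - E_LJ(N)) / (tN) ≤ 𝓔_W(x^N) / N ≤ (E_LJ(N) - E_{LJ-tW}(N)) / (tN)`,

so the two one-sided finite-`N` "no corner" clauses with slope `P.energyPerParticle W` squeeze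
`𝓔_W(x^N) / N → P.energyPerParticle W` along EVERY sequence of Lennard-Jones ground states and
every `C²` compactly supported `W` (the `T = 0`, single-potential shadow of "differentiability of
the pressure ⇔ unique tangent functional").

Ingredients (all in-tree / Mathlib): a continuous compactly supported `W` is bounded
(`Continuous.bounded_above_of_compact_support`), so `V_LJ ± tW ≥ -1/12 - tC`
(`neg_one_div_le_lennardJones`) and `groundStateEnergy_le_of_le` applies to the injective ground
state; `interactionEnergy` is linear in the potential (finite sums); `Metric.tendsto_nhds` with
`ε/2` and `t = t₀/2`.
-/

namespace Summit.AtomisticToContinuum.Crystallization.Theorems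

open Literature.MathematicalPhysics.StatisticalMechanics Filter

/-- Linearity of the interaction energy in the pair potential:
`𝓔_{V + tW}(x) = 𝓔_V(x) + t·𝓔_W(x)` (finite sums). -/
theorem interactionEnergy_add_mul {d N : ℕ} (V W : ℝ → ℝ) (t : ℝ)
    (x : Fin N → EuclideanSpace ℝ (Fin d)) :
    interactionEnergy (fun r => V r + t * W r) x =
      interactionEnergy V x + t * interactionEnergy W x := by
  simp only [interactionEnergy, Finset.sum_add_distrib, Finset.mul_sum]

/-- Linearity of the interaction energy in the pair potential:
`𝓔_{V - tW}(x) = 𝓔_V(x) - t·𝓔_W(x)` (finite sums). -/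
theorem interactionEnergy_sub_mul {d N : ℕ} (V W : ℝ → ℝ) (t : ℝ)
    (x : Fin N → EuclideanSpace ℝ (Fin d)) :
    interactionEnergy (fun r => V r - t * W r) x =
      interactionEnergy V x - t * interactionEnergy W x := by
  simp only [interactionEnergy, Finset.sum_sub_distrib, Finset.mul_sum]

/-- Upper supergradient bound. For a Lennard-Jones ground state `x` of `N` particles in `ℝ³`, a
perturbation `W` with `‖W r‖ ≤ C` and `t > 0`: `V_LJ + tW ≥ -1/12 - tC` is bounded below, so
`E_{LJ+tW}(N) ≤ 𝓔_{LJ+tW}(x) = E_LJ(N) + t·𝓔_W(x)`, whence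
`(E_{LJ+tW}(N) - E_LJ(N)) / (tN) ≤ 𝓔_W(x) / N`. -/
theorem groundStateEnergy_add_sub_div_le_interactionEnergy_div {N : ℕ} {W : ℝ → ℝ} {C : ℝ}
    (hC : ∀ r, ‖W r‖ ≤ C) {t : ℝ} (ht : 0 < t) {x : Fin N → EuclideanSpace ℝ (Fin 3)}
    (hx : IsGroundState lennardJones x) :
    (groundStateEnergy (fun r => lennardJones r + t * W r) 3 N -
        groundStateEnergy lennardJones 3 N) / (t * (N : ℝ)) ≤
      interactionEnergy W x / N := by
  have hlow : ∀ r, -1 / 12 - t * C ≤ lennardJones r + t * W r := by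
    intro r
    have h1 := neg_one_div_le_lennardJones r
    have h2 : -C ≤ W r := by
      have h := hC r
      rw [Real.norm_eq_abs] at h
      exact (abs_le.1 h).1
    have h3 : t * (-C) ≤ t * W r := mul_le_mul_of_nonneg_left h2 ht.le
    linarith
  have hE := groundStateEnergy_le_of_le (fun r => lennardJones r + t * W r) hlow hx.1
  rw [interactionEnergy_add_mul, hx.2] at hE
  have hnum : groundStateEnergy (fun r => lennardJones r + t * W r) 3 N -
      groundStateEnergy lennardJones 3 N ≤ t * interactionEnergy W x := by
    linarith
  calc (groundStateEnergy (fun r => lennardJones r + t * W r) 3 N -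
          groundStateEnergy lennardJones 3 N) / (t * (N : ℝ))
        ≤ t * interactionEnergy W x / (t * (N : ℝ)) :=
          div_le_div_of_nonneg_right hnum (by positivity)
    _ = interactionEnergy W x / N := mul_div_mul_left _ _ ht.ne'

/-- Lower supergradient bound. For a Lennard-Jones ground state `x` of `N` particles in `ℝ³`, a
perturbation `W` with `‖W r‖ ≤ C` and `t > 0`: `V_LJ - tW ≥ -1/12 - tC` is bounded below, so
`E_{LJ-tW}(N) ≤ 𝓔_{LJ-tW}(x) = E_LJ(N) - t·𝓔_W(x)`, whence
`𝓔_W(x) / N ≤ (E_LJ(N) - E_{LJ-tW}(N)) / (tN)`. -/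
theorem interactionEnergy_div_le_groundStateEnergy_sub_sub_div {N : ℕ} {W : ℝ → ℝ} {C : ℝ}
    (hC : ∀ r, ‖W r‖ ≤ C) {t : ℝ} (ht : 0 < t) {x : Fin N → EuclideanSpace ℝ (Fin 3)}
    (hx : IsGroundState lennardJones x) :
    interactionEnergy W x / N ≤
      (groundStateEnergy lennardJones 3 N -
        groundStateEnergy (fun r => lennardJones r - t * W r) 3 N) / (t * (N : ℝ)) := by
  have hlow : ∀ r, -1 / 12 - t * C ≤ lennardJones r - t * W r := by
    intro r
    have h1 := neg_one_div_le_lennardJones r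
    have h2 : W r ≤ C := by
      have h := hC r
      rw [Real.norm_eq_abs] at h
      exact (abs_le.1 h).2
    have h3 : t * W r ≤ t * C := mul_le_mul_of_nonneg_left h2 ht.le
    linarith
  have hE := groundStateEnergy_le_of_le (fun r => lennardJones r - t * W r) hlow hx.1
  rw [interactionEnergy_sub_mul, hx.2] at hE
  have hnum : t * interactionEnergy W x ≤ groundStateEnergy lennardJones 3 N -
      groundStateEnergy (fun r => lennardJones r - t * W r) 3 N := by
    linarith
  calc interactionEnergy W x / N
        = t * interactionEnergy W x / (t * (N : ℝ)) := (mul_div_mul_left _ _ ht.ne').symm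
    _ ≤ (groundStateEnergy lennardJones 3 N -
          groundStateEnergy (fun r => lennardJones r - t * W r) 3 N) / (t * (N : ℝ)) :=
          div_le_div_of_nonneg_right hnum (by positivity)

/-- **Item stmt-AtomisticToContinuum-12283** (`SupergradientSandwich`, route `EnergyDerivativeOrder`).
For any periodic configuration `P` of `ℝ³`: if `t ↦ lim_N E_{LJ+tW}(N)/N` has NO CORNER at
`t = 0` with slope `P.energyPerParticle W` for every `C²` compactly supported `W` (the two
one-sided finite-`N` clauses), then for EVERY sequence of Lennard-Jones ground states `x^N` and
every such `W`, `𝓔_W(x^N) / N → P.energyPerParticle W`.  Proof: `W` is bounded, so by the two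
supergradient bounds above `(E_{LJ+tW}(N) - E_LJ(N))/(tN) ≤ 𝓔_W(x^N)/N ≤
(E_LJ(N) - E_{LJ-tW}(N))/(tN)` for `t > 0`; given `ε > 0` take `t₀` from the no-corner clause at
`ε/2` and `t = t₀/2`, so eventually `|𝓔_W(x^N)/N - P.energyPerParticle W| ≤ ε/2 < ε`. -/
theorem supergradientSandwich_proof :
    Summit.AtomisticToContinuum.Crystallization.Theses.EnergyDerivativeOrder.SupergradientSandwich := by
  unfold Summit.AtomisticToContinuum.Crystallization.Theses.EnergyDerivativeOrder.SupergradientSandwich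
  intro P hNC x hx W hW hWc
  obtain ⟨C, hC⟩ := hW.continuous.bounded_above_of_compact_support hWc
  rw [Metric.tendsto_nhds]
  intro ε hε
  obtain ⟨t₀, ht₀, ht⟩ := hNC W hW hWc (ε / 2) (half_pos hε)
  obtain ⟨hlo, hhi⟩ := ht (t₀ / 2) (half_pos ht₀) (half_lt_self ht₀)
  filter_upwards [hlo, hhi] with N hN₁ hN₂
  have h₁ := groundStateEnergy_add_sub_div_le_interactionEnergy_div hC (half_pos ht₀) (hx N)
  have h₂ := interactionEnergy_div_le_groundStateEnergy_sub_sub_div hC (half_pos ht₀) (hx N)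
  rw [Real.dist_eq, abs_lt]
  constructor <;> linarith

end Summit.AtomisticToContinuum.Crystallization.Theorems
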